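/-
Copyright (c) 2026. All rights reserved.
Released under Apache 2.0 license as described in the file LICENSE.
Authors: abc-iut cell, prover seat abc-iut-L4-t10 (gen 14; row «COR510iv-HOL-MONO-CLOSE», abc-iut-L4-lead m174 (2)), over
abc-iut-L4-d3's typed sentence (`LogFrobeniusMonoTelecoreHolCompatible`), abc-iut-f-101's `monoTelecore` / `DiagramSinkSystems` /
`DiagramSinkSystems`, abc-iut-L4-t5's `anTelecoreE` and this seat's files 1–3 (consumed BY NAME, nothing restated).
-/
import Literature.AnabelianGeometry.AbsoluteAnabelian.LogFrobeniusHolMonoSinks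
import Literature.AnabelianGeometry.AbsoluteAnabelian.LogFrobeniusMonoTelecoreGenuineOpen
import HarnessLib

/-!
# [AbsTopIII] Cor 5.10 (iv)(c): `𝔗_{An⊢}`, `ℋ_{An⊢}` and `𝔗_{An•}`, `ℋ_{An•}` in ONE family on the common super-diagram — SUFFICIENCY,
# and the instance at the genuine open-augmentation carrier

S. Mochizuki, *Topics in absolute anabelian geometry III: global reconstruction algorithms* [MochizukiAbsTopIII2015];
manuscript `paper:url-5493eb38cbb7`, read on the page: Cor 5.10 (iv)(c) p. 148 l. 41–45 («… generate a contact structure `ℋ_{An⊢}` on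
`𝔗_{An⊢}` that is compatible with the telecore and contact structures `𝔗_{An•}`, `ℋ_{An•}` of Corollary 5.5, (ii)»), Cor 5.5 (ii)
pp. 130–131 (`𝔗_{An•}`, `ℋ_{An•}`), Def 3.5 (ii) p. 75 («compatible» = contained in ONE family of homotopies with the same homotopies),
(iv) p. 76 (telecores; a contact structure is a family «compatible with `𝒥`»), Rmk 3.5.1 p. 78 (structure functors).

PROOF-SIDE file 4/4: the CLOSER of abc-iut-L4-d3's `LogFrobeniusSetting.Cor510MonoContactHolCompatible` (p501764; row
«COR510iv-HOL-MONO-CLOSE»).  Construction (abc-iut-f-101's sink-system method, `DiagramSinkSystems`): on the common super-diagram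
(file 1's `supDiagram` = abc-iut-L4-d3's `holMonoDiagram` at the printed telecore edges) flag the two core vertices `An•[𝒳]` and
`An⊢[𝒩⊢⊞]`; the sink at `An⊢` is ALL pairs with abc-iut-L4-t5's lifts through the identity structure functor of file 1's `supOver`; the
sink at `An•[𝒳]` is the universal family of `D_{An•}` (lifts through `κ_{An•}⁻¹` over `Th•[Z]`, abc-iut-L4-t5) read in the super-diagram
along the sieve `embHolSuper` (abc-iut-f-101's `LiftPair`); the one interaction — PUSHING a pair at `An•[𝒳]` along a path into `An⊢`
gives the lift there — holds because every sink homotopy LIES OVER the core (file 2's ★ `isOver_sup_of_isOver_hol`) and the lift is the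
unique such transformation (Rmk 3.5.1); no path returns from `An⊢` to `An•[𝒳]` (file 1).  Results:

* (file 3, `LogFrobeniusHolMonoSinks`: `supSink`, `supSinkSystem`, ★ `holMonoFamily` — the sinks, the sink system, the family `K`);
* `compatibleAlongMonoSuper_jfam` / `compatibleAlongHolSuper_jfam` — `K` contains abc-iut-f-101's telecore family `𝒥_{An⊢}`
  (`monoTelecore hN hψ`) along `embMonoSuper` and abc-iut-L4-t5's telecore family `𝒥_{An•}` (`anTelecoreE`) along `embHolSuper`,
  with (heterogeneously) the same homotopies;
* ★ `cor510MonoContactHolCompatible_of` — **SUFFICIENCY: (a) `hN` + (c) `hψ` ⇒ `Cor510MonoContactHolCompatible L`** for every setting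
  with `V(F_mod) ≠ ∅`; ★★ `cor510MonoContactHolCompatible_genuineOpen` — the sentence HOLDS at the genuine open-augmentation carrier
  `genuineOpen p V` (zero hypotheses beyond `V ≠ ∅`), `…_iff` with abc-iut-L4-d3's degenerate corner.

HONEST SCOPE: the contact structures bound here are the telecore families themselves (`ℋ := 𝒥`, a contact structure by Def 3.5 (iv)
trivially; abc-iut-L4-t5's `cor55Telecore_of_anTelecoreE` binds the same family for `ℋ_{An•}`) — exactly what the typed sentence asks
(its `ℋ`-binders are constrained by `IsContactStructure` only; the printed generators are «not pinned», abc-iut-L4-d3's honest scope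
(2)); `K` is NOT shown to contain abc-iut-f-101's PINNED contact structure `monoContact` (the `(γ¹_{v,ν}, γ⁰_{v,ν})` pairs at `𝒩⊢⊞_v`) —
that stronger closer needs a third flag at `𝒩⊢⊞_v` with the framed lifts re-derived on the super-diagram (successor row).  OUR kernel
constructions over abc-iut-L4-t3's typed §5 interface; refereed pre-IUT material; nothing here bears on [IUTchIII] Cor. 3.12; no side taken;
typed ≠ proved.
-/

set_option autoImplicit false

universe u v₁ u₁

open CategoryTheory Quiver

namespace Literature.AnabelianGeometry.AbsoluteAnabelian

namespace LogFrobeniusSetting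

open DiagramOfCategories

variable {Vmod : Type u} {isArc : Vmod → Bool} (L : LogFrobeniusSetting Vmod isArc)

/-! ## `K` contains the two telecore families, along the two inclusions -/

section Compatible

variable (hN : ∀ v : Vmod, L.monoN v ⋙ L.toEmono v ≅ L.toE v ⋙ L.monoAn)
  (hψ : ∀ (w : Vmod) (j : {ν : LogVertex (isArc w) // ν.IsCross}),
    L.ψAnMono w j ⋙ L.forgetMono w ⋙ L.toEmono w ≅ L.κAnMono.inverse)

/-- Whiskering on the right respects heterogeneous equality (bookkeeping, same categories). [folklore] -/
private theorem whiskerRight_heq_aux {A B B' : Type*} [Category A] [Category B] [Category B'] {F G F' G' : A ⥤ B}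
    (hF : F = F') (hG : G = G') {α : F ⟶ G} {α' : F' ⟶ G'} (h : HEq α α') {T T' : B ⥤ B'} (hT : T = T') :
    HEq (Functor.whiskerRight α T) (Functor.whiskerRight α' T') := by
  subst hF hG hT
  cases h
  rfl

/-- `eqToHom`-conjugates of heterogeneously equal transformations are heterogeneously equal (bookkeeping). [folklore] -/
private theorem conj_heq_conj {A B A' B' : Type u₁} [Category.{v₁} A] [Category.{v₁} B] [Category.{v₁} A'] [Category.{v₁} B']
    {F₁ F₂ G₁ G₂ : A ⥤ B}
    {F₁' F₂' G₁' G₂' : A' ⥤ B'} (a : F₁ = F₂) {θ : F₂ ⟶ G₂} (b : G₂ = G₁) (a' : F₁' = F₂') {θ' : F₂' ⟶ G₂'} (b' : G₂' = G₁')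
    (h : HEq θ θ') :
    HEq (eqToHom a ≫ θ ≫ eqToHom b) (eqToHom a' ≫ θ' ≫ eqToHom b') :=
  (HomotopyFamily.heq_eqToHom_comp_comp_eqToHom a b θ).trans (h.trans (HomotopyFamily.heq_eqToHom_comp_comp_eqToHom a' b' θ').symm)

/-- **`K` contains the telecore family `𝒥_{An⊢}` of `𝔗_{An⊢}`** (abc-iut-f-101's `monoTelecore hN hψ`) along the base inclusion
`embMonoSuper`, with the same homotopies: a telecore pair `([γ₃]∘[γ₁], [γ₃]∘[γ₂])` is the member `(γ₁, γ₂)` of the sink at `An⊢`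
whiskered by `γ₃`, and both families give abc-iut-L4-t5's lift at `An⊢` whiskered (file 1's `lift_embMono_heq`).
[cite: MochizukiAbsTopIII2015, Cor 5.10 (iv)(c) p. 148] -/
theorem compatibleAlongMonoSuper_jfam [Nonempty Vmod] :
    L.CompatibleAlongMonoSuper anJ monoJ L.anTel L.monoTelMap (L.holMonoFamily hN hψ) (L.monoTelecore hN hψ).Jfam := by
  intro a b P Q h
  obtain ⟨⟨w, hw, p₁, q₁, s, hP, hQ⟩⟩ := h
  subst hw
  have hP' : (embMono Vmod isArc).mapPath P = ((embMono Vmod isArc).mapPath p₁).comp ((embMono Vmod isArc).mapPath s) := by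
    rw [hP, Prefunctor.mapPath_comp]
  have hQ' : (embMono Vmod isArc).mapPath Q = ((embMono Vmod isArc).mapPath q₁).comp ((embMono Vmod isArc).mapPath s) := by
    rw [hQ, Prefunctor.mapPath_comp]
  obtain ⟨h', e⟩ := (L.supSinkSystem hN hψ).family_η_tail
    (show (L.supSinkSystem hN hψ).E ((embMono Vmod isArc).mapPath p₁) ((embMono Vmod isArc).mapPath q₁) from trivial)
    ((embMono Vmod isArc).mapPath s) hP' hQ'
  refine ⟨h', ?_⟩
  change HEq ((univFamily (L.monoTeleOver hN hψ) (· = (monoTeleShape Vmod isArc).obs) (L.monoTeleOver_ff hN hψ)).η _)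
    ((L.supSinkSystem hN hψ).family.η h')
  rw [e, univFamily_η_eq (L.monoTeleOver hN hψ) (· = (monoTeleShape Vmod isArc).obs) (L.monoTeleOver_ff hN hψ) _
    ⟨(monoTeleShape Vmod isArc).obs, rfl, p₁, q₁, s, hP, hQ⟩]
  -- both sides: the lift at `An⊢` whiskered by `[γ₃]`, conjugated by `eqToHom`s
  exact conj_heq_conj _ _ _ _ (whiskerRight_heq_aux (L.supDiagram.pathFunctor_comapAlong (embMono Vmod isArc) p₁)
    (L.supDiagram.pathFunctor_comapAlong (embMono Vmod isArc) q₁) (L.lift_embMono_heq hN hψ p₁ q₁)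
    (L.supDiagram.pathFunctor_comapAlong (embMono Vmod isArc) s))

/-- The vertex categories of `D_{An•}` and of the super-diagram agree along `embHolSuper` (bookkeeping). [folklore] -/
private theorem obj_eq_of_diagram_eq {W : Type*} [Quiver W] {D₁ D₂ : DiagramOfCategories W} (h : D₁ = D₂)
    (a : W) : D₁.obj a = D₂.obj a := by
  rw [h]

/-- … with the same category structures (bookkeeping). [folklore] -/
private theorem cat_heq_of_diagram_eq {W : Type*} [Quiver W] {D₁ D₂ : DiagramOfCategories W} (h : D₁ = D₂)
    (a : W) : HEq (D₁.cat a) (D₂.cat a) := by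
  subst h
  rfl

/-- **`K` contains the telecore family `𝒥_{An•}` of `𝔗_{An•}`** (abc-iut-L4-t5's `anTelecoreE`) along `embHolSuper`, with the same
homotopies: a telecore pair `([γ₃]∘[γ₁], [γ₃]∘[γ₂])` of `D_{An•}` is the member `(γ₁, γ₂)` of the sink at `An•[𝒳]` (an embedded pair of
the universal family) whiskered by `γ₃`; abc-iut-L4-t5's `anTelecoreE_Jfam_η` gives the same whiskered lift on the other side, the two lifts
agreeing along file 1's `anDiagram_eq_comapAlong` / `anOverE_heq_holOverE`. [cite: MochizukiAbsTopIII2015, Cor 5.10 (iv)(c) p. 148] -/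
theorem compatibleAlongHolSuper_jfam [Nonempty Vmod] :
    L.CompatibleAlongHolSuper anJ monoJ L.anTel L.monoTelMap (L.holMonoFamily hN hψ) L.anTelecoreE.Jfam := by
  intro a b P Q h
  obtain ⟨⟨w, hw, p₁, q₁, s, hP, hQ⟩⟩ := h
  subst hw
  -- the member at `An•[𝒳]`: the embedded pair `(γ₁, γ₂)` of the universal family of `D_{An•}`
  have mem : L.holUniv.E p₁ q₁ := ⟨⟨(anShape (Vmod := Vmod) (isArc := isArc)).obs, rfl, p₁, q₁, Path.nil, rfl, rfl⟩⟩
  have hE : (L.supSinkSystem hN hψ).E ((embHol Vmod isArc).mapPath p₁) ((embHol Vmod isArc).mapPath q₁) :=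
    ⟨LiftPair.ofMem mem⟩
  have hP' : (embHol Vmod isArc).mapPath P = ((embHol Vmod isArc).mapPath p₁).comp ((embHol Vmod isArc).mapPath s) := by
    rw [hP, Prefunctor.mapPath_comp]
  have hQ' : (embHol Vmod isArc).mapPath Q = ((embHol Vmod isArc).mapPath q₁).comp ((embHol Vmod isArc).mapPath s) := by
    rw [hQ, Prefunctor.mapPath_comp]
  obtain ⟨h', e⟩ := (L.supSinkSystem hN hψ).family_η_tail hE ((embHol Vmod isArc).mapPath s) hP' hQ'
  refine ⟨h', (heq_of_eq (L.anTelecoreE_Jfam_η _ p₁ q₁ s hP hQ)).trans (HEq.trans ?_ (heq_of_eq e).symm)⟩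
  -- the member's homotopy is the lift at `An•[𝒳]` (through `κ_{An•}⁻¹`), conjugated
  have e0 : (L.supSinkSystem hN hψ).η hE = eqToHom (L.supDiagram.pathFunctor_comapAlong (embHol Vmod isArc) p₁).symm ≫
      L.holOverE.lift (L.holW_ff _ rfl) p₁ q₁ ≫ eqToHom (L.supDiagram.pathFunctor_comapAlong (embHol Vmod isArc) q₁) := by
    have hη : L.holUniv.η mem = L.holOverE.lift (L.holW_ff _ rfl) p₁ q₁ :=
      univFamily_η_eq_lift L.holOverE (· = (anShape (Vmod := Vmod) (isArc := isArc)).obs) L.holW_ff rfl p₁ q₁ mem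
    change liftη (embHol Vmod isArc) L.supDiagram (anShape (Vmod := Vmod) (isArc := isArc)).obs L.holUniv _ = _
    rw [liftη_eq graphEmbedding_embHol _ (LiftPair.ofMem mem), LiftPair.hom_ofMem, hη]
  unfold tailHom
  rw [e0]
  -- compare the whiskered lifts: abc-iut-L4-t5's `anOverE` on `anDiagram` versus `holOverE` on the pulled-back presentation
  have hD := L.anDiagram_eq_comapAlong
  have hlift : HEq (L.anOverE.lift L.anOverE_ff_obs p₁ q₁) (L.holOverE.lift (L.holW_ff _ rfl) p₁ q₁) :=
    OverData.lift_heq_of_eq hD L.anOverE_heq_holOverE HEq.rfl p₁ q₁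
  have hinner : HEq (L.holOverE.lift (L.holW_ff _ rfl) p₁ q₁)
      (eqToHom (L.supDiagram.pathFunctor_comapAlong (embHol Vmod isArc) p₁).symm ≫ L.holOverE.lift (L.holW_ff _ rfl) p₁ q₁ ≫
        eqToHom (L.supDiagram.pathFunctor_comapAlong (embHol Vmod isArc) q₁)) :=
    (HomotopyFamily.heq_eqToHom_comp_comp_eqToHom _ _ _).symm
  refine conj_heq_conj _ _ _ _ ?_
  exact Functor.whiskerRight_heq'' (obj_eq_of_diagram_eq hD a) (cat_heq_of_diagram_eq hD a)
    (obj_eq_of_diagram_eq hD _) (cat_heq_of_diagram_eq hD _) (obj_eq_of_diagram_eq hD b) (cat_heq_of_diagram_eq hD b)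
    ((DiagramOfCategories.pathFunctor_heq_of_eq hD p₁).trans
      (heq_of_eq (L.supDiagram.pathFunctor_comapAlong (embHol Vmod isArc) p₁)))
    ((DiagramOfCategories.pathFunctor_heq_of_eq hD q₁).trans
      (heq_of_eq (L.supDiagram.pathFunctor_comapAlong (embHol Vmod isArc) q₁)))
    (hlift.trans hinner)
    ((DiagramOfCategories.pathFunctor_heq_of_eq hD s).trans (heq_of_eq (L.supDiagram.pathFunctor_comapAlong (embHol Vmod isArc) s)))

/-- A telecore family is a contact structure for its own telecore (Def 3.5 (iv): «compatible with `𝒥`», witnessed by `𝒥` itself).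
[cite: MochizukiAbsTopIII2015, Definition 3.5 (iv) p.76] -/
theorem isContactStructure_jfam_self {W : Type*} [Quiver W] {D : DiagramOfCategories W} {S : D.Observable}
    {hS : S.IsCore} (T : D.Telecore S hS) : Telecore.IsContactStructure D T T.Jfam := by
  refine ⟨T.Jfam, fun b => ?_⟩
  cases b
  · exact ⟨fun _ _ _ _ h => h, fun _ _ _ _ _ => rfl⟩
  · exact ⟨fun _ _ _ _ h => h, fun _ _ _ _ _ => rfl⟩

end Compatible

/-! ## Corollary 5.10 (iv)(c): the holomorphic-compatibility sentence — SUFFICIENCY and the genuine instance -/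

section Closer

variable (hN : ∀ v : Vmod, L.monoN v ⋙ L.toEmono v ≅ L.toE v ⋙ L.monoAn)
  (hψ : ∀ (w : Vmod) (j : {ν : LogVertex (isArc w) // ν.IsCross}),
    L.ψAnMono w j ⋙ L.forgetMono w ⋙ L.toEmono w ≅ L.κAnMono.inverse)

include hN hψ in
/-- ★ **SUFFICIENCY for the holomorphic-compatibility sentence of Cor 5.10 (iv)(c)**: for every setting with `V(F_mod) ≠ ∅`, the
printed data (a) `hN` (Def 5.6 (iv) rows-4→5 mono-analyticization homotopies) and (c) `hψ` («`ψ^{An⊢⊞}_{w,ν}` lies over `ℰ⊢`»,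
Prop 5.8 (vii)) give abc-iut-L4-d3's `Cor510MonoContactHolCompatible L`: the telecore `𝔗_{An•}` (abc-iut-L4-t5's `anTelecoreE`,
edges `φ_⋏ = φ_{An•}` pinned) and the telecore `𝔗_{An⊢}` (abc-iut-f-101's `monoTelecore hN hψ`, edges `φ^{An⊢⊞}_{w,ν}` pinned), each
with its telecore family as contact structure, sit inside ONE family of homotopies `K` on the common super-diagram — Def 3.5 (ii)
«compatible».  (Scope: `ℋ := 𝒥` on both sides, as the typed sentence allows; abc-iut-f-101's pinned `monoContact` is not
addressed here.) [cite: MochizukiAbsTopIII2015, Cor 5.10 (iv)(c) p. 148] -/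
theorem cor510MonoContactHolCompatible_of [Nonempty Vmod] : L.Cor510MonoContactHolCompatible :=
  ⟨_, _, L.anCoreObsE_isCore, L.anTelecoreE, rfl, HEq.rfl, L.anTelecoreE.Jfam, isContactStructure_jfam_self L.anTelecoreE,
    _, _, L.monoCoreObs_isCore hN, L.monoTelecore hN hψ, rfl, HEq.rfl, (L.monoTelecore hN hψ).Jfam,
    isContactStructure_jfam_self (L.monoTelecore hN hψ), L.holMonoFamily hN hψ,
    L.compatibleAlongMonoSuper_jfam hN hψ, L.compatibleAlongMonoSuper_jfam hN hψ,
    L.compatibleAlongHolSuper_jfam hN hψ, L.compatibleAlongHolSuper_jfam hN hψ⟩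

include hN hψ in
/-- The sentence holds iff `V(F_mod) ≠ ∅`, given (a) and (c) (abc-iut-L4-d3's degenerate corner
`not_cor510MonoContactHolCompatible_of_isEmpty`). [cite: MochizukiAbsTopIII2015, Cor 5.10 (iv)(c) p. 148] -/
theorem cor510MonoContactHolCompatible_iff_nonempty : L.Cor510MonoContactHolCompatible ↔ Nonempty Vmod := by
  refine ⟨fun h => ?_, fun _ => L.cor510MonoContactHolCompatible_of hN hψ⟩
  by_contra hV
  haveI : IsEmpty Vmod := not_nonempty_iff.mp hV
  exact L.not_cor510MonoContactHolCompatible_of_isEmpty h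

end Closer

end LogFrobeniusSetting

/-! ## The instance at the genuine open-augmentation carrier -/

namespace LogFrobeniusSetting

/-- ★★ **Cor 5.10 (iv)(c), holomorphic-compatibility sentence, AT THE GENUINE OPEN-AUGMENTATION CARRIER** `genuineOpen p V`
(abc-iut-f-101's / abc-iut-w5-d053's genuine nonarchimedean mono-analytic model on `𝒳^{open}`; zero hypotheses beyond `V ≠ ∅`):
the rows-4→5 squares commute on the nose and «`ψ^{An⊢⊞}` lies over `ℰ⊢`» by abc-iut-w4-d095's `nonarchGenuineMonoAnPfOpen_ψOverIso`.
[cite: MochizukiAbsTopIII2015, Cor 5.10 (iv)(c) p. 148] -/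
theorem cor510MonoContactHolCompatible_genuineOpen (p : ℕ) [Fact p.Prime] (Vmod : Type 1) [Nonempty Vmod] :
    (genuineOpen p Vmod).Cor510MonoContactHolCompatible :=
  (genuineOpen p Vmod).cor510MonoContactHolCompatible_of (fun _ => Iso.refl _)
    (fun w j => nonarchGenuineMonoAnPfOpen_ψOverIso p Vmod (fun _ => false) w j)

/-- **The statement at the genuine carrier EXACTLY**: it holds iff `V(F_mod) ≠ ∅`. [cite: MochizukiAbsTopIII2015, Cor 5.10 (iv)(c) p. 148] -/
theorem cor510MonoContactHolCompatible_genuineOpen_iff (p : ℕ) [Fact p.Prime] (Vmod : Type 1) :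
    (genuineOpen p Vmod).Cor510MonoContactHolCompatible ↔ Nonempty Vmod :=
  (genuineOpen p Vmod).cor510MonoContactHolCompatible_iff_nonempty (fun _ => Iso.refl _)
    (fun w j => nonarchGenuineMonoAnPfOpen_ψOverIso p Vmod (fun _ => false) w j)

/-- Hence a §5 setting with `V(F_mod) ≠ ∅` satisfying the typed holomorphic-compatibility sentence EXISTS (model-level non-vacuity of
abc-iut-L4-d3's `Cor510MonoContactHolCompatible`). [cite: MochizukiAbsTopIII2015, Cor 5.10 (iv)(c) p. 148] -/
theorem exists_genuine_cor510MonoContactHolCompatible (p : ℕ) [Fact p.Prime] (Vmod : Type 1) [Nonempty Vmod] :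
    ∃ L : LogFrobeniusSetting Vmod (fun _ => false), L.Cor510MonoContactHolCompatible :=
  ⟨genuineOpen p Vmod, cor510MonoContactHolCompatible_genuineOpen p Vmod⟩

end LogFrobeniusSetting

end Literature.AnabelianGeometry.AbsoluteAnabelian
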